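import Mathlib.Combinatorics.SimpleGraph.Acyclic
import Mathlib.Tactic.Linarith
import Mathlib.Tactic.Positivity
import Mathlib.Tactic.Ring
import HarnessLib

/-!
# Monotone connection probabilities imply positively correlated connection events

An abstract Harris-type induction for **pinned set families** and its specialisation to the
uniform spanning forests of a finite graph (the arboreal gas at unit activity).

**Pinned families.** For a predicate `P` on finite edge sets, an edge system `D` and a *pinned*
set `K` (disjoint from `D`) put `𝓕(D;K) = {G ⊆ D : P (G ∪ K)}`; events are read on `G ∪ K`.
Conditioning the uniform measure on `𝓕(D;K)` on `f ∉ G` gives `𝓕(D ∖ f; K)`, on `f ∈ G` gives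
(`G ↦ G ∖ f`) `𝓕(D ∖ f; K ∪ f)` (`card_pinned_split`). Hence the deletion/pinning mixture identity
`Cov = λ Cov₁ + (1-λ) Cov₂ + λ(1-λ) Δ_U Δ_W` and:

* `card_mul_card_inter_ge_of_monotone` — if two events `U`, `W` both have a nonnegative influence
  from every coordinate under every pinning (`#𝓕(D;K∪f)[U] · #𝓕(D;K) ≥ #𝓕(D;K)[U] · #𝓕(D;K∪f)`),
  then they are positively correlated in every `𝓕(D;K)`:
  `#𝓕(D;K) · #𝓕(D;K)[U ∧ W] ≥ #𝓕(D;K)[U] · #𝓕(D;K)[W]` (counting form, integer arithmetic only).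

**Forests.** With `P X = ⟨X⟩ acyclic` the family `𝓕(D;K)` is the set of spanning forests of the
multigraph `⟨D ∪ K⟩ / K` (forests of `D ∪ K` containing the forest `K`), and `a ~_{G ∪ K} b` is
connection in that contraction. The hypothesis for `U = {a ~ b}` says that *connection probabilities
of the uniform spanning forest of every minor are nondecreasing under insertion of an edge*; by
`ForestExchange.negCorr_iff_connEdge` (this directory) this is exactly the negative edge-correlation
of uniform forests on all minors — the conjecture of Kahn (2000), Grimmett–Winkler (2004) and
Pemantle, open (Bauerschmidt–Helmuth, *Spin systems with hyperbolic symmetry: a survey*, §5.2,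
eq. (5.5): «negative correlation for all weights is equivalent to all connection probabilities
being increasing in all weights»). The conclusion `forests_conn_posCorr_of_connMonotone` is the
Griffiths-type **positive correlation of connection events** `P(a~b ∧ c~d) ≥ P(a~b)·P(c~d)` for the
uniform forests of every minor. So the value-wise arboreal-gas corollary of the forest-layer
conjecture FL of memo KCLUSTER-gen85 is implied by forest negative correlation (memo KCLUSTER-gen86,
Theorem A); unconditionally it holds on the independence-correlated class of Semple–Welsh
(*Negative correlation in graphs and matroids*, CPC 2008, Thm 4.2/4.4: series–parallel graphs,
`K₄` and its minors, closed under minors, series–parallel extension and 2-sums).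

Theorems only; no definitions, no `sorry`; families are written as `Finset.filter`s of powersets.
-/

open Finset SimpleGraph

namespace Summit.CriticalPhenomena.PercolationContinuityZ3.Theorems.ConnMonotone

/-! ### §1 Integer arithmetic of the deletion/pinning mixture -/

/-- **Mixture lemma.** If `U`, `W` are positively correlated inside each of two sub-populations
(`uᵢ vᵢ ≤ Nᵢ wᵢ`, where `uᵢ, vᵢ, wᵢ ≤ Nᵢ` count `U`, `W`, `U ∧ W`) and population 2 is richer than
population 1 in BOTH events (`N₂ u₁ ≤ N₁ u₂`, `N₂ v₁ ≤ N₁ v₂`), then `U`, `W` are positively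
correlated in the union: `(u₁+u₂)(v₁+v₂) ≤ (N₁+N₂)(w₁+w₂)`. This is the counting form of
`Cov = λCov₁ + (1-λ)Cov₂ + λ(1-λ)Δ_UΔ_W`. [elementary] -/
theorem mixture_le (N₁ N₂ u₁ u₂ v₁ v₂ w₁ w₂ : ℕ) (h₁ : u₁ * v₁ ≤ N₁ * w₁)
    (h₂ : u₂ * v₂ ≤ N₂ * w₂) (hu : N₂ * u₁ ≤ N₁ * u₂) (hv : N₂ * v₁ ≤ N₁ * v₂)
    (bu₁ : u₁ ≤ N₁) (bv₁ : v₁ ≤ N₁) (bu₂ : u₂ ≤ N₂) (bv₂ : v₂ ≤ N₂) :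
    (u₁ + u₂) * (v₁ + v₂) ≤ (N₁ + N₂) * (w₁ + w₂) := by
  rcases Nat.eq_zero_or_pos N₁ with h01 | hN₁
  · subst h01
    have hu₁ : u₁ = 0 := by omega
    have hv₁ : v₁ = 0 := by omega
    subst hu₁
    subst hv₁
    calc (0 + u₂) * (0 + v₂) = u₂ * v₂ := by ring
      _ ≤ N₂ * w₂ := h₂
      _ ≤ (0 + N₂) * (w₁ + w₂) := by nlinarith [Nat.zero_le (N₂ * w₁)]
  rcases Nat.eq_zero_or_pos N₂ with h02 | hN₂
  · subst h02
    have hu₂ : u₂ = 0 := by omega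
    have hv₂ : v₂ = 0 := by omega
    subst hu₂
    subst hv₂
    calc (u₁ + 0) * (v₁ + 0) = u₁ * v₁ := by ring
      _ ≤ N₁ * w₁ := h₁
      _ ≤ (N₁ + 0) * (w₁ + w₂) := by nlinarith [Nat.zero_le (N₁ * w₂)]
  -- both populations nonempty: multiply through by N₁ N₂
  have hX : (0 : ℤ) ≤ ((N₁ : ℤ) * u₂ - N₂ * u₁) := by
    have := (Int.ofNat_le.2 hu)
    push_cast at this
    linarith
  have hY : (0 : ℤ) ≤ ((N₁ : ℤ) * v₂ - N₂ * v₁) := by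
    have := (Int.ofNat_le.2 hv)
    push_cast at this
    linarith
  have hXY := mul_nonneg hX hY
  have h₁' : (u₁ : ℤ) * v₁ ≤ N₁ * w₁ := by exact_mod_cast h₁
  have h₂' : (u₂ : ℤ) * v₂ ≤ N₂ * w₂ := by exact_mod_cast h₂
  have key : ((N₁ : ℤ) * N₂) * ((u₁ + u₂) * (v₁ + v₂)) ≤ ((N₁ : ℤ) * N₂) * ((N₁ + N₂) * (w₁ + w₂)) := by
    have e : ((N₁ : ℤ) * N₂) * ((N₁ + N₂) * (w₁ + w₂)) - ((N₁ : ℤ) * N₂) * ((u₁ + u₂) * (v₁ + v₂))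
        = N₂ * (N₁ + N₂) * (N₁ * w₁ - u₁ * v₁) + N₁ * (N₁ + N₂) * (N₂ * w₂ - u₂ * v₂)
          + (N₁ * u₂ - N₂ * u₁) * (N₁ * v₂ - N₂ * v₁) := by ring
    have hA : (0 : ℤ) ≤ N₂ * (N₁ + N₂) * (N₁ * w₁ - u₁ * v₁) := by
      apply mul_nonneg
      · positivity
      · linarith
    have hB : (0 : ℤ) ≤ N₁ * (N₁ + N₂) * (N₂ * w₂ - u₂ * v₂) := by
      apply mul_nonneg
      · positivity
      · linarith
    linarith
  have hpos : (0 : ℤ) < (N₁ : ℤ) * N₂ := by positivity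
  have := le_of_mul_le_mul_left key hpos
  exact_mod_cast this

/-! ### §2 Pinned families: conditioning on one coordinate -/

variable {α : Type*} [DecidableEq α]

omit [DecidableEq α] in
/-- For `f ∈ G`: `(G ∖ f) ∪ (K ∪ f) = G ∪ K`. [elementary] -/
theorem erase_union_insert [DecidableEq α] {G K : Finset α} {f : α} (hf : f ∈ G) :
    G.erase f ∪ insert f K = G ∪ K := by
  ext x
  simp only [Finset.mem_union, Finset.mem_erase, Finset.mem_insert]
  constructor
  · rintro (⟨_, hx⟩ | rfl | hx)
    · exact Or.inl hx
    · exact Or.inl hf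
    · exact Or.inr hx
  · rintro (hx | hx)
    · by_cases h : x = f
      · exact Or.inr (Or.inl h)
      · exact Or.inl ⟨h, hx⟩
    · exact Or.inr (Or.inr hx)

/-- **Conditioning a pinned family on one coordinate.** For `f ∈ D`, the members of
`𝓕_Q(D;K) = {G ⊆ D : Q (G ∪ K)}` avoiding `f` form `𝓕_Q(D ∖ f; K)`, and `G ↦ G ∖ f` maps those
containing `f` bijectively onto `𝓕_Q(D ∖ f; K ∪ f)`; hence the cardinalities add. [elementary] -/
theorem card_pinned_split (Q : Finset α → Prop) [DecidablePred Q] (D K : Finset α) {f : α} (hf : f ∈ D) :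
    #(D.powerset.filter fun G => Q (G ∪ K)) =
      #((D.erase f).powerset.filter fun G => Q (G ∪ K)) +
        #((D.erase f).powerset.filter fun G => Q (G ∪ insert f K)) := by
  rw [← Finset.card_filter_add_card_filter_not (fun G : Finset α => f ∉ G)]
  congr 1
  · congr 1
    ext G
    simp only [Finset.mem_filter, Finset.mem_powerset]
    constructor
    · rintro ⟨⟨hGD, hQ⟩, hfG⟩
      exact ⟨fun x hx => Finset.mem_erase.2 ⟨fun h => hfG (h ▸ hx), hGD hx⟩, hQ⟩
    · rintro ⟨hGD, hQ⟩
      exact ⟨⟨fun x hx => (Finset.mem_erase.1 (hGD hx)).2, hQ⟩,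
        fun h => (Finset.mem_erase.1 (hGD h)).1 rfl⟩
  · refine Finset.card_bij' (fun G _ => G.erase f) (fun G _ => insert f G) ?_ ?_ ?_ ?_
    · intro G hG
      simp only [Finset.mem_filter, Finset.mem_powerset, not_not] at hG ⊢
      obtain ⟨⟨hGD, hQ⟩, hfG⟩ := hG
      refine ⟨fun x hx => ?_, by rwa [erase_union_insert hfG]⟩
      rcases Finset.mem_erase.1 hx with ⟨hxf, hxG⟩
      exact Finset.mem_erase.2 ⟨hxf, hGD hxG⟩
    · intro G hG
      simp only [Finset.mem_filter, Finset.mem_powerset, not_not] at hG ⊢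
      obtain ⟨hGD, hQ⟩ := hG
      have hfG : f ∉ G := fun h => (Finset.mem_erase.1 (hGD h)).1 rfl
      refine ⟨⟨?_, ?_⟩, Finset.mem_insert_self _ _⟩
      · intro x hx
        rcases Finset.mem_insert.1 hx with rfl | hx
        · exact hf
        · exact (Finset.mem_erase.1 (hGD hx)).2
      · have : insert f G ∪ K = G ∪ insert f K := by
          ext x
          simp only [Finset.mem_union, Finset.mem_insert]
          tauto
        rwa [this]
    · intro G hG
      simp only [Finset.mem_filter, not_not] at hG
      exact Finset.insert_erase hG.2
    · intro G hG
      simp only [Finset.mem_filter, Finset.mem_powerset] at hG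
      have hfG : f ∉ G := fun h => (Finset.mem_erase.1 (hG.1 h)).1 rfl
      exact Finset.erase_insert hfG

/-! ### §3 The abstract theorem -/

/-- **Monotone influences imply positive correlation (pinned families).** Let `P`, `U`, `W` be
predicates on finite sets and `𝓕(D;K) = {G ⊆ D : P (G ∪ K)}`. Suppose that for every `D`, every
pinned `K` and every new coordinate `f` the pinned family is at least as rich in `U` as the plain
one, `#𝓕(D;K)[U] · #𝓕(D;K ∪ f) ≤ #𝓕(D;K ∪ f)[U] · #𝓕(D;K)`, and likewise for `W` (nonnegative
single-coordinate influences under every conditioning). Then for every `D` and every `K` disjoint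
from `D`, `U` and `W` are positively correlated in `𝓕(D;K)`:
`#𝓕(D;K)[U] · #𝓕(D;K)[W] ≤ #𝓕(D;K) · #𝓕(D;K)[U ∧ W]`. Proof: induction on `#D`, conditioning on
one coordinate (`card_pinned_split`) and `mixture_le`. [Harris-type induction; elementary] -/
theorem card_mul_card_inter_ge_of_monotone (P U W : Finset α → Prop) [DecidablePred P]
    [DecidablePred U] [DecidablePred W]
    (hU : ∀ (D K : Finset α) (f : α), f ∉ D → f ∉ K →
      #((D.powerset.filter fun G => P (G ∪ K)).filter fun G => U (G ∪ K)) *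
          #(D.powerset.filter fun G => P (G ∪ insert f K)) ≤
        #((D.powerset.filter fun G => P (G ∪ insert f K)).filter fun G => U (G ∪ insert f K)) *
          #(D.powerset.filter fun G => P (G ∪ K)))
    (hW : ∀ (D K : Finset α) (f : α), f ∉ D → f ∉ K →
      #((D.powerset.filter fun G => P (G ∪ K)).filter fun G => W (G ∪ K)) *
          #(D.powerset.filter fun G => P (G ∪ insert f K)) ≤
        #((D.powerset.filter fun G => P (G ∪ insert f K)).filter fun G => W (G ∪ insert f K)) *
          #(D.powerset.filter fun G => P (G ∪ K)))
    (D K : Finset α) (hDK : Disjoint D K) :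
    #((D.powerset.filter fun G => P (G ∪ K)).filter fun G => U (G ∪ K)) *
        #((D.powerset.filter fun G => P (G ∪ K)).filter fun G => W (G ∪ K)) ≤
      #(D.powerset.filter fun G => P (G ∪ K)) *
        #((D.powerset.filter fun G => P (G ∪ K)).filter fun G => U (G ∪ K) ∧ W (G ∪ K)) := by
  -- rewrite all double filters as single filters of the powerset
  simp only [Finset.filter_filter]
  obtain ⟨n, hn⟩ : ∃ n, D.card = n := ⟨_, rfl⟩
  induction n generalizing D K with
  | zero =>
    have hD : D = ∅ := Finset.card_eq_zero.1 hn
    subst hD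
    simp only [Finset.powerset_empty, Finset.filter_singleton, Finset.empty_union]
    by_cases hP : P K <;> by_cases hU' : U K <;> by_cases hW' : W K <;> simp [hP, hU', hW']
  | succ n ih =>
    obtain ⟨f, hf⟩ : D.Nonempty := Finset.card_pos.1 (by omega)
    have hfK : f ∉ K := fun h => Finset.disjoint_left.1 hDK hf h
    have hcard : (D.erase f).card = n := by rw [Finset.card_erase_of_mem hf, hn]; rfl
    have hfD' : f ∉ D.erase f := Finset.notMem_erase f D
    have hdis₁ : Disjoint (D.erase f) K := (Finset.disjoint_of_subset_left (Finset.erase_subset f D) hDK)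
    have hdis₂ : Disjoint (D.erase f) (insert f K) := by
      rw [Finset.disjoint_insert_right]; exact ⟨hfD', hdis₁⟩
    -- the four splittings
    have sN := card_pinned_split (fun X => P X) D K hf
    have sU := card_pinned_split (fun X => P X ∧ U X) D K hf
    have sW := card_pinned_split (fun X => P X ∧ W X) D K hf
    have sUW := card_pinned_split (fun X => P X ∧ (U X ∧ W X)) D K hf
    rw [sN, sU, sW, sUW]
    -- induction hypotheses for the two parts
    have ih₁ := ih (D.erase f) K hdis₁ hcard
    have ih₂ := ih (D.erase f) (insert f K) hdis₂ hcard
    -- monotone influences (population 2 = pinned is richer)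
    have mU := hU (D.erase f) K f hfD' hfK
    have mW := hW (D.erase f) K f hfD' hfK
    simp only [Finset.filter_filter] at mU mW
    -- trivial bounds `#𝓕[Q] ≤ #𝓕`
    have bU : ∀ K' : Finset α,
        #((D.erase f).powerset.filter fun G => P (G ∪ K') ∧ U (G ∪ K')) ≤
          #((D.erase f).powerset.filter fun G => P (G ∪ K')) := fun K' =>
      Finset.card_le_card fun G hG => by
        simp only [Finset.mem_filter] at hG ⊢
        exact ⟨hG.1, hG.2.1⟩
    have bW : ∀ K' : Finset α,
        #((D.erase f).powerset.filter fun G => P (G ∪ K') ∧ W (G ∪ K')) ≤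
          #((D.erase f).powerset.filter fun G => P (G ∪ K')) := fun K' =>
      Finset.card_le_card fun G hG => by
        simp only [Finset.mem_filter] at hG ⊢
        exact ⟨hG.1, hG.2.1⟩
    have mU' := ((mul_comm _ _).trans_le mU).trans_eq (mul_comm _ _)
    have mW' := ((mul_comm _ _).trans_le mW).trans_eq (mul_comm _ _)
    exact mixture_le _ _ _ _ _ _ _ _ ih₁ ih₂ mU' mW' (bU K) (bW K) (bU _) (bW _)

/-! ### §4 Uniform spanning forests: connection monotonicity ⇒ connection events positively correlated -/

section Forests
open scoped Classical

variable {V : Type*} [DecidableEq V]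

/-- **Theorem A (uniform weights, counting form).** Write `𝓕(D;K) = {G ⊆ D : ⟨G ∪ K⟩ acyclic}`
for the spanning forests of the edge system `D ∪ K` that contain the pinned forest `K` (= the
spanning forests of the minor `⟨D ∪ K⟩/K`), and `x ~ y` for connection in `⟨G ∪ K⟩`.
HYPOTHESIS (connection monotonicity on all minors; ⟺ Kahn–Grimmett–Winkler negative edge
correlation of uniform forests on all minors, via `ForestExchange.negCorr_iff_connEdge`): for all
`D, K, f, x, y`, `#𝓕(D;K)[x~y] · #𝓕(D;K∪f) ≤ #𝓕(D;K∪f)[x~y] · #𝓕(D;K)`.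
CONCLUSION (Griffiths-type positive correlation of connection events for the uniform spanning
forest of every minor): `#𝓕(D;K)[a~b] · #𝓕(D;K)[c~d] ≤ #𝓕(D;K) · #𝓕(D;K)[a~b ∧ c~d]`.
[memo KCLUSTER-gen86 Thm A; the weighted/value-wise form and the unconditional series–parallel
case (Semple–Welsh 2008) are proved on paper there] -/
theorem forests_conn_posCorr_of_connMonotone
    (hmono : ∀ (D K : Finset (Sym2 V)) (f : Sym2 V) (x y : V), f ∉ D → f ∉ K →
      #((D.powerset.filter fun G => (fromEdgeSet ((G ∪ K : Finset (Sym2 V)) : Set (Sym2 V))).IsAcyclic).filter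
            fun G => (fromEdgeSet ((G ∪ K : Finset (Sym2 V)) : Set (Sym2 V))).Reachable x y) *
          #(D.powerset.filter fun G =>
            (fromEdgeSet ((G ∪ insert f K : Finset (Sym2 V)) : Set (Sym2 V))).IsAcyclic) ≤
        #((D.powerset.filter fun G =>
            (fromEdgeSet ((G ∪ insert f K : Finset (Sym2 V)) : Set (Sym2 V))).IsAcyclic).filter
            fun G => (fromEdgeSet ((G ∪ insert f K : Finset (Sym2 V)) : Set (Sym2 V))).Reachable x y) *
          #(D.powerset.filter fun G => (fromEdgeSet ((G ∪ K : Finset (Sym2 V)) : Set (Sym2 V))).IsAcyclic))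
    (D K : Finset (Sym2 V)) (hDK : Disjoint D K) (a b c d : V) :
    #((D.powerset.filter fun G => (fromEdgeSet ((G ∪ K : Finset (Sym2 V)) : Set (Sym2 V))).IsAcyclic).filter
          fun G => (fromEdgeSet ((G ∪ K : Finset (Sym2 V)) : Set (Sym2 V))).Reachable a b) *
        #((D.powerset.filter fun G => (fromEdgeSet ((G ∪ K : Finset (Sym2 V)) : Set (Sym2 V))).IsAcyclic).filter
          fun G => (fromEdgeSet ((G ∪ K : Finset (Sym2 V)) : Set (Sym2 V))).Reachable c d) ≤
      #(D.powerset.filter fun G => (fromEdgeSet ((G ∪ K : Finset (Sym2 V)) : Set (Sym2 V))).IsAcyclic) *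
        #((D.powerset.filter fun G => (fromEdgeSet ((G ∪ K : Finset (Sym2 V)) : Set (Sym2 V))).IsAcyclic).filter
          fun G => (fromEdgeSet ((G ∪ K : Finset (Sym2 V)) : Set (Sym2 V))).Reachable a b ∧
            (fromEdgeSet ((G ∪ K : Finset (Sym2 V)) : Set (Sym2 V))).Reachable c d) :=
  card_mul_card_inter_ge_of_monotone
    (fun X => (fromEdgeSet ((X : Finset (Sym2 V)) : Set (Sym2 V))).IsAcyclic)
    (fun X => (fromEdgeSet ((X : Finset (Sym2 V)) : Set (Sym2 V))).Reachable a b)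
    (fun X => (fromEdgeSet ((X : Finset (Sym2 V)) : Set (Sym2 V))).Reachable c d)
    (fun D K f hf hfK => hmono D K f a b hf hfK) (fun D K f hf hfK => hmono D K f c d hf hfK) D K hDK

/-- **Theorem A, unpinned form** (`K = ∅`): if connection probabilities of the uniform spanning
forest are monotone under edge insertion on every minor (hypothesis as in
`forests_conn_posCorr_of_connMonotone`), then for the uniform spanning forest `F` of any finite
edge system `D` and any vertices `a b c d`,
`#{a ~_F b} · #{c ~_F d} ≤ #𝓕(D) · #{a ~_F b ∧ c ~_F d}`, i.e. `P(a~b ∧ c~d) ≥ P(a~b)·P(c~d)`.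
[memo KCLUSTER-gen86 Thm A] -/
theorem forests_conn_posCorr_of_connMonotone_unpinned
    (hmono : ∀ (D K : Finset (Sym2 V)) (f : Sym2 V) (x y : V), f ∉ D → f ∉ K →
      #((D.powerset.filter fun G => (fromEdgeSet ((G ∪ K : Finset (Sym2 V)) : Set (Sym2 V))).IsAcyclic).filter
            fun G => (fromEdgeSet ((G ∪ K : Finset (Sym2 V)) : Set (Sym2 V))).Reachable x y) *
          #(D.powerset.filter fun G =>
            (fromEdgeSet ((G ∪ insert f K : Finset (Sym2 V)) : Set (Sym2 V))).IsAcyclic) ≤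
        #((D.powerset.filter fun G =>
            (fromEdgeSet ((G ∪ insert f K : Finset (Sym2 V)) : Set (Sym2 V))).IsAcyclic).filter
            fun G => (fromEdgeSet ((G ∪ insert f K : Finset (Sym2 V)) : Set (Sym2 V))).Reachable x y) *
          #(D.powerset.filter fun G => (fromEdgeSet ((G ∪ K : Finset (Sym2 V)) : Set (Sym2 V))).IsAcyclic))
    (D : Finset (Sym2 V)) (a b c d : V) :
    #((D.powerset.filter fun G => (fromEdgeSet ((G : Finset (Sym2 V)) : Set (Sym2 V))).IsAcyclic).filter
          fun G => (fromEdgeSet ((G : Finset (Sym2 V)) : Set (Sym2 V))).Reachable a b) *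
        #((D.powerset.filter fun G => (fromEdgeSet ((G : Finset (Sym2 V)) : Set (Sym2 V))).IsAcyclic).filter
          fun G => (fromEdgeSet ((G : Finset (Sym2 V)) : Set (Sym2 V))).Reachable c d) ≤
      #(D.powerset.filter fun G => (fromEdgeSet ((G : Finset (Sym2 V)) : Set (Sym2 V))).IsAcyclic) *
        #((D.powerset.filter fun G => (fromEdgeSet ((G : Finset (Sym2 V)) : Set (Sym2 V))).IsAcyclic).filter
          fun G => (fromEdgeSet ((G : Finset (Sym2 V)) : Set (Sym2 V))).Reachable a b ∧
            (fromEdgeSet ((G : Finset (Sym2 V)) : Set (Sym2 V))).Reachable c d) := by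
  simpa only [Finset.union_empty] using
    forests_conn_posCorr_of_connMonotone hmono D ∅ (Finset.disjoint_empty_right D) a b c d

end Forests

end Summit.CriticalPhenomena.PercolationContinuityZ3.Theorems.ConnMonotone
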